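import Summits.Langlands.Langlands.Theses.OrdinaryPrimeTransport
import Summits.Langlands.Langlands.Theorems.IrreducibilityBySelfDualityIrreducibleOffSectorOfWeak
import Summits.Langlands.Langlands.Theorems.IrreducibilityBySelfDualityReciprocityUpToIrreducibilityWeakAutomorphyOfFontaineMazur
import Literature.NumberTheory.Automorphic.PairLFunctionPolesRepDataOfHumphriesJo
import HarnessLib

/-!
# Birth skeleton (BC3) for crux stmt-Langlands-17214
`Summit.Langlands.Langlands.Theses.OrdinaryPrimeTransport.IrreducibleOffPrimeRankSector` — line `birth`

Route `route-Langlands-OrdinaryPrimeTransport` (rev 13; deciding theorem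
`closes : SummandsPotentiallyAutomorphic → OrdinaryPrimeExists → RankinSelbergPoleCountR → PrimeRankTransport →
IrreducibleOffPrimeRankSector → ReciprocityUpToIrreducibility → IrreducibleAvatarsConjugate → Langlands`).
The crux is the route's OPEN COMPONENT at rank 9 ("the rest of the irreducibility clause", grounded
open-problem 2026-08-16): for every `n ≥ 1`, number field `K`, L-algebraic cuspidal `π` of `GL_n(𝔸_K)`
NOT in the prime-rank sector

  `Sector(n, K, π) := (K totally real ∨ CM) ∧ n prime ∧ 3 ≤ n ∧ (π has a regular infinity type) ∧
                      (π is not essentially self-dual at Satake level)`,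

every `ρ : Γ_K → GL_n(ℚ̄_ℓ)` Satake–Frobenius compatible with `(π, ι)` at almost all places is irreducible,
for every `ℓ, ι`.

## The line: the isobaric bootstrap (Ramakrishnan 2008 §0, Calegari–Gee 2013 §1.1), cut along the sector

"Cuspidal ⇒ irreducible" has exactly one structural engine in print and in the tree: if an avatar `ρ₀` of a
cuspidal `π` is GEOMETRIC (unramified a.e., de Rham above `ℓ`) then its irreducible constituents `r_i` are
geometric of ranks `m_i < n` (Jordan–Hölder + Fontaine heredity, LANDED: `exists_geometricConstituents`,
`stub_deRhamBlocks`, p99702/p98936); if each `r_i` is weakly automorphic (`r_i ↔ σ_i` cuspidal on `GL_{m_i}`,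
a.e.) then the Satake family of `π` is a.e. the union of those of the `σ_i`, which Jacquet–Shalika isobaric
rigidity forbids for `k ≥ 2` constituents (LANDED: `isobaricRigidity_of_JS`, p102635, from Arthur–Clozel
(2.2)–(2.3)); irreducibility then passes from `ρ₀` to EVERY a.e.-compatible `ρ` by Chebotarev–Brauer–Nesbitt
(LANDED: `isIrreducible_of_satakeFrobCompatible`, p79199).  The whole engine is the landed pointwise-weak
bootstrap `IrreducibleOffSector.isIrreducible_of_geometric_of_weakAutomorphyBelow` (p112357).  Its unproved
inputs are this skeleton's four stubs:

* `stub_weakExistenceOffSector` — W OFF THE SECTOR (Buzzard–Gee Conj. 3.2.2, existence half, weak form,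
  restricted to the `π` this crux is about: THE STUB THAT USES THE CRUX'S HYPOTHESIS).  It is implied
  verbatim by the unrestricted W registered on stmt-Langlands-14328's and stmt-Langlands-14329's lines
  (`weakExistenceOffSector_of_weakExistence` below, one line), and what it drops is exactly the KNOWN part
  of W (regular algebraic `π` over totally real / CM `K`: Harris–Lan–Taylor–Thorne Thm. A, Scholze V.4.2,
  de Rham by Caraiani–Newton / A'Campo); what remains is open (irregular `π`, general `K`, and the
  polarized / composite-rank regular cases only through the same theorems plus bookkeeping).
* `stub_fontaineMazurLanglandsGLn` — lang.S03, the accepted Literature conjecture text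
  `FontaineMazurLanglandsGLn` at the pinned period-ring family, every rank (OPEN; VERBATIM the stub
  registered on 14328's line and on 14329's line rev 6); it yields B_w (weak automorphy of irreducible
  pinned-geometric `ρ`) by the landed bridge `stub_weakAutomorphy_of_fontaineMazurLanglandsGLn` (p117444).
* `stub_pairLBoundaryJS` — Arthur–Clozel (2.2) for Borel–Jacquet data, the Literature named fact
  `JacquetShalika1981_partialPairL_boundary_repData` BY NAME (a THEOREM of the literature, T0 debt of the
  tree; = item stmt-Langlands-13622 `IrreducibilityBySelfDuality.PairLBoundaryJS` up to unfolding).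
* `stub_humphriesJo_three_le` — Humphries–Jo (2024) archimedean Rankin–Selberg test vectors in ranks `≥ 3`
  (a THEOREM of the literature; VERBATIM the stub of 14328's / 14329's lines); it yields Arthur–Clozel (2.3)
  in every rank by the landed `JacquetShalika1981_partialPairL_pole_repData_of_humphriesJo_three_le`.

`IrreducibleOffPrimeRankSector_of` (kernel-checked, no `sorry`; hypotheses = the four stub statements by
name via `_Goal.stub_x := type_of% @stub_x`; conclusion = the route decl BY NAME): for an off-sector `π`,
W-off gives a pinned-geometric avatar `ρ₀`, and the landed bootstrap does the rest.  `lean check`: sorries =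
the four stubs, nothing else.

Disproof used: none exists for this crux (`ledger crux ls stmt-Langlands-17214` 2026-08-17: no workfiles;
no `Theorems/IrreducibleOffPrimeRankSector/Negative/`).  Negatives index (3 entries: SplitPrimeInduction
deinduction, the route's own rank-0 `RankinSelbergPoleCount`, K3 Serre-type anchor): none is a stub here.
Dead lines: none recorded on this crux.  Nearest line: `Cruxes/IrreducibleOffSector/Lines/Sketch.lean`
rev 6 (sibling crux stmt-Langlands-14329, same engine, sector `n = 3 ∧ CM ∧ regular` idle there) — this
file is its transport to the prime-rank sector with W cut along the sector.

References: D. Ramakrishnan, *Irreducibility and cuspidality*, Progr. Math. 270 (2008) §0; F. Calegari,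
T. Gee, Ann. Inst. Fourier 63 (2013) §1.1 [CalegariGee2013]; K. Buzzard, T. Gee, LMS LNS 414 (2014)
Conj. 3.2.1–3.2.2 [BuzzardGeeLMS2014]; J.-M. Fontaine, B. Mazur (1995) Conj. 1 [FontaineMazurGeometric1995];
J. Arthur, L. Clozel, Ann. Math. Stud. 120, Ch. 3 §2 (2.2)–(2.3) [ArthurClozelAMS120]; H. Jacquet,
J. Shalika, AJM 103 (1981) [JacquetShalikaAJM1981, JacquetShalikaAJM1981II]; P. Humphries, Y. Jo,
Math. Z. (2024) Thm. 1.1 / 5.6 [HumphriesJo2024]; M. Harris, K.-W. Lan, R. Taylor, J. Thorne (2016) Thm. A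
[HarrisLanTaylorThorneRMS2016].
-/

noncomputable section

set_option linter.dupNamespace false -- project-wide option; `Summit.Langlands.Langlands` is the mandated namespace

open scoped NumberField
open Filter IsDedekindDomain
open Literature.NumberTheory.Automorphic Literature.NumberTheory.GaloisRepresentations
open Summit.Langlands
open Summit.Langlands.Langlands.Theses.OrdinaryPrimeTransport (IrreducibleOffPrimeRankSector)

namespace Summit.Langlands.Langlands.Cruxes.IrreducibleOffPrimeRankSector.Birth

/-! ## 1. The four stubs (the ONLY sorries of this file) -/

/-- **stub W-off — weak existence OFF the prime-rank sector** (Buzzard–Gee Conj. 3.2.2, existence half,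
weak form, for exactly the `π` of the crux): every L-algebraic cuspidal `π` of `GL_n(𝔸_K)` (`n ≥ 1`) that is
NOT in the sector `(K TR ∨ CM) ∧ n prime ∧ 3 ≤ n ∧ regular infinity type ∧ not essentially self-dual at
Satake level` has, for all `ℓ, ι`, SOME `ρ₀ : Γ_K → GL_n(ℚ̄_ℓ)` unramified almost everywhere, de Rham above
`ℓ` for Fontaine's pinned datum, and Satake–Frobenius compatible with `(π, ι)` almost everywhere.  OPEN off
the regular-algebraic TR/CM world (irregular `π`: NonRegularWeightBarrier; `K` neither totally real nor CM:
no avatars known); the antecedent is VERBATIM the crux's.  Why it might fail: only as Buzzard–Gee 3.2.2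
itself might (no candidate counterexample in print). [cite: BuzzardGeeLMS2014, Conj. 3.2.2]
[cite: HarrisLanTaylorThorneRMS2016, Thm. A] -/
theorem stub_weakExistenceOffSector :
    ∀ (n : ℕ) (K : Type) [Field K] [NumberField K] (hcpt : isCompact_glFiniteIntegralLevel n K),
      0 < n → ∀ (π : CuspidalAutomorphicRepData n K hcpt), π.1.IsLAlgebraic →
        ¬ ((NumberField.IsTotallyReal K ∨ NumberField.IsCMField K) ∧ Nat.Prime n ∧ 3 ≤ n ∧
            (∃ T : Literature.NumberTheory.Automorphic.InfinityType K n,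
              π.1.HasInfinityType T ∧ T.IsRegular) ∧
            ∀ (h1 : Literature.NumberTheory.Automorphic.isCompact_glFiniteIntegralLevel 1 K)
              (η : Literature.NumberTheory.Automorphic.CuspidalAutomorphicRepData 1 K h1),
              ¬ (∀ᶠ v : IsDedekindDomain.HeightOneSpectrum (NumberField.RingOfIntegers K) in Filter.cofinite,
                  ∀ α : Multiset ℂ, π.1.HasSatakeParamAt v α →
                    ∃ e : ℂ, η.1.HasSatakeParamAt v {e} ∧
                      α.map (fun a => a⁻¹) = α.map (fun a => e * a))) →
        ∀ (ℓ : ℕ) [Fact ℓ.Prime] (ι : PadicAlgCl ℓ ≃+* ℂ),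
          ∃ ρ₀ : FramedGaloisRep K (PadicAlgCl ℓ) n,
            ((∀ᶠ v : HeightOneSpectrum (𝓞 K) in cofinite, ρ₀.IsUnramifiedAt v) ∧
              ∀ (v : HeightOneSpectrum (𝓞 K)) (hv : ((ℓ : ℕ) : 𝓞 K) ∈ v.asIdeal),
                (Literature.NumberTheory.PAdicHodge.fontainePstAdicCompletion v ℓ hv).IsDeRhamFramed
                  (ρ₀.toLocal v)) ∧
            ∀ᶠ v : HeightOneSpectrum (𝓞 K) in cofinite, SatakeFrobCompatibleAt ι π.1 ρ₀ v := by
  sorry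

/-- **stub lang.S03 — Fontaine–Mazur–Langlands for `GL_n`, every rank, at the pinned period-ring family**
(OPEN; the accepted Literature conjecture text `FontaineMazurLanglandsGLn`; VERBATIM the stub registered on
stmt-Langlands-14328's line and on stmt-Langlands-14329's line rev 6): every irreducible
`ρ : Γ_K → GL_n(ℚ̄_ℓ)` with a geometric finite model is Satake–Frobenius compatible a.e. with some
L-algebraic cuspidal `π`.  It yields B_w by the landed `stub_weakAutomorphy_of_fontaineMazurLanglandsGLn`.
Why it might fail: it is Fontaine–Mazur Conj. 1 + Langlands for all `n` and `K` (summit direction (B) in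
weak form). [cite: FontaineMazurGeometric1995, Conj. 1] [cite: BuzzardGeeLMS2014, Conj. 3.2.2] -/
theorem stub_fontaineMazurLanglandsGLn :
    ∀ n : ℕ, FontaineMazurLanglandsGLn
      (fun (K : Type) [Field K] [NumberField K] (ℓ : ℕ) [Fact ℓ.Prime]
          (v : HeightOneSpectrum (𝓞 K)) (hv : ((ℓ : ℕ) : 𝓞 K) ∈ v.asIdeal) =>
        ⟨(Literature.NumberTheory.PAdicHodge.fontainePstAdicCompletion v ℓ hv).algebra,
          (Literature.NumberTheory.PAdicHodge.fontainePstAdicCompletion v ℓ hv).𝔅⟩) n := by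
  sorry

/-- **stub JS (2.2)** — Jacquet–Shalika 1981 / Arthur–Clozel Ch. 3 (2.2) for cuspidal Borel–Jacquet data,
the Literature named fact BY NAME (a THEOREM of the literature, T0 debt of the tree; the text of item
stmt-Langlands-13622 `IrreducibilityBySelfDuality.PairLBoundaryJS` up to unfolding `partialPairL`).
[cite: ArthurClozelAMS120, Ch. 3 §2 (2.2)] [cite: JacquetShalikaAJM1981II, Prop. 3.6 and Thm. 4.4] -/
theorem stub_pairLBoundaryJS :
    Literature.NumberTheory.Automorphic.JacquetShalika1981_partialPairL_boundary_repData := by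
  sorry

/-- **stub HJ** — Humphries–Jo (2024) Thm. 1.1 / Thm. 5.6: archimedean test vectors for the `GL_N × GL_N`
Rankin–Selberg integral (with absolute convergence for unitary data) in ranks `N ≥ 3` over every number
field, the Literature named fact `HumphriesJo2024_archRankinSelberg_testVector N K` (a THEOREM of the
literature; VERBATIM the stub of 14328's / 14329's lines).  By the tree's
`JacquetShalika1981_partialPairL_pole_repData_of_humphriesJo_three_le` it gives Arthur–Clozel (2.3) for
Borel–Jacquet data in every rank. [cite: HumphriesJo2024, Thm. 1.1, Thm. 5.6]
[cite: JacquetShalikaAJM1981II, Prop. 3.6] -/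
theorem stub_humphriesJo_three_le :
    ∀ (N : ℕ) (K : Type) [Field K] [NumberField K],
      3 ≤ N → HumphriesJo2024_archRankinSelberg_testVector N K := by
  sorry

/-! ## 2. The stub statements as named propositions (hypotheses of the composition, admissible by stub name)

Each `_Goal.stub_x` is `type_of% @stub_x`: literally the stub's statement, no text duplicated, no `sorry`
inherited. -/

namespace _Goal

/-- The statement of `stub_weakExistenceOffSector` (literally its type). [folklore] -/
def stub_weakExistenceOffSector : Prop :=
  type_of% @Summit.Langlands.Langlands.Cruxes.IrreducibleOffPrimeRankSector.Birth.stub_weakExistenceOffSector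

/-- The statement of `stub_fontaineMazurLanglandsGLn` (literally its type). [folklore] -/
def stub_fontaineMazurLanglandsGLn : Prop :=
  type_of% @Summit.Langlands.Langlands.Cruxes.IrreducibleOffPrimeRankSector.Birth.stub_fontaineMazurLanglandsGLn

/-- The statement of `stub_pairLBoundaryJS` (literally its type). [folklore] -/
def stub_pairLBoundaryJS : Prop :=
  type_of% @Summit.Langlands.Langlands.Cruxes.IrreducibleOffPrimeRankSector.Birth.stub_pairLBoundaryJS

/-- The statement of `stub_humphriesJo_three_le` (literally its type). [folklore] -/
def stub_humphriesJo_three_le : Prop :=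
  type_of% @Summit.Langlands.Langlands.Cruxes.IrreducibleOffPrimeRankSector.Birth.stub_humphriesJo_three_le

end _Goal

/-! ## 3. The composition (kernel-checked, no `sorry`): W-off → lang.S03 → JS (2.2) → HJ → the crux -/

/-- **`IrreducibleOffPrimeRankSector` from its four stubs.**  For an off-sector L-algebraic cuspidal `π`,
W-off (fed with the crux's own hypothesis) gives a pinned-geometric avatar `ρ₀` a.e.-compatible with
`(π, ι)`; lang.S03 gives weak automorphy of irreducible pinned-geometric representations in every rank
(landed bridge `stub_weakAutomorphy_of_fontaineMazurLanglandsGLn`); Humphries–Jo in ranks `≥ 3` gives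
Arthur–Clozel (2.3) in every rank (landed `JacquetShalika1981_partialPairL_pole_repData_of_humphriesJo_three_le`);
and the landed pointwise-weak isobaric bootstrap `isIrreducible_of_geometric_of_weakAutomorphyBelow`
(geometric constituents + de Rham heredity + isobaric rigidity + Chebotarev–Brauer–Nesbitt) makes every
a.e.-compatible `ρ` irreducible.  Hypotheses = the four stub statements by name; conclusion = the route decl
by name. [cite: CalegariGee2013, §1.1] [cite: BuzzardGeeLMS2014, Conj. 3.2.2]
[cite: ArthurClozelAMS120, Ch. 3 §2 (2.2)–(2.3)] -/
theorem IrreducibleOffPrimeRankSector_of (hW : _Goal.stub_weakExistenceOffSector)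
    (hFML : _Goal.stub_fontaineMazurLanglandsGLn) (h22 : _Goal.stub_pairLBoundaryJS)
    (hHJ : _Goal.stub_humphriesJo_three_le) : IrreducibleOffPrimeRankSector := by
  dsimp only [_Goal.stub_weakExistenceOffSector, _Goal.stub_fontaineMazurLanglandsGLn,
    _Goal.stub_pairLBoundaryJS, _Goal.stub_humphriesJo_three_le] at hW hFML h22 hHJ
  -- Arthur–Clozel (2.3) for Borel–Jacquet data in every rank, from Humphries–Jo in ranks ≥ 3
  have h23 : JacquetShalika1981_partialPairL_pole_repData :=
    JacquetShalika1981_partialPairL_pole_repData_of_humphriesJo_three_le hHJ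
  -- B_w (weak automorphy of irreducible pinned-geometric ρ, every rank) from lang.S03
  have hBw :=
    Summit.Langlands.Langlands.Theorems.ReciprocityUpToIrreducibility.stub_weakAutomorphy_of_fontaineMazurLanglandsGLn
      hFML
  -- the crux: an off-sector π has a pinned-geometric avatar (W-off), then the landed bootstrap
  intro n K _ _ hcpt hn π hL hS ℓ _ ι ρ hρ
  obtain ⟨ρ₀, hgeo₀, hρ₀⟩ := hW n K hcpt hn π hL hS ℓ ι
  exact Summit.Langlands.Langlands.Theorems.IrreducibleOffSector.isIrreducible_of_geometric_of_weakAutomorphyBelow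
    h22 h23 hn π ι hgeo₀ hρ₀
    (fun m hm _ hcm r hirr hgeo => (hBw K m hcm hm ℓ ι r hirr hgeo).imp fun _ h => h.2) ρ hρ

/-- By-name sanity check (an `example`, not a declaration): the four stubs feed the composition as they
stand. -/
example : IrreducibleOffPrimeRankSector :=
  IrreducibleOffPrimeRankSector_of stub_weakExistenceOffSector stub_fontaineMazurLanglandsGLn
    stub_pairLBoundaryJS stub_humphriesJo_three_le

/-! ## 4. Dedup remark (sorry-free): W-off is implied by the unrestricted W of the sibling lines -/

/-- The unrestricted weak-existence stub W — VERBATIM `stub_weakExistence` as registered on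
stmt-Langlands-14328's line (`Cruxes/ReciprocityUpToIrreducibility/Lines/Sketch.lean`) and on
stmt-Langlands-14329's line (`Cruxes/IrreducibleOffSector/Lines/Sketch.lean` rev 6) — implies this line's
`stub_weakExistenceOffSector` by discarding the sector hypothesis: any proof of W discharges W-off in one
line. [cite: BuzzardGeeLMS2014, Conj. 3.2.2] -/
theorem weakExistenceOffSector_of_weakExistence
    (hW : ∀ (K : Type) [Field K] [NumberField K] (n : ℕ) (hcpt : isCompact_glFiniteIntegralLevel n K),
      0 < n → ∀ π : CuspidalAutomorphicRepData n K hcpt, π.1.IsLAlgebraic →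
        ∀ (ℓ : ℕ) [Fact ℓ.Prime] (ι : PadicAlgCl ℓ ≃+* ℂ),
          ∃ ρ : FramedGaloisRep K (PadicAlgCl ℓ) n,
            ((∀ᶠ v : HeightOneSpectrum (𝓞 K) in cofinite, ρ.IsUnramifiedAt v) ∧
              ∀ (v : HeightOneSpectrum (𝓞 K)) (hv : ((ℓ : ℕ) : 𝓞 K) ∈ v.asIdeal),
                (Literature.NumberTheory.PAdicHodge.fontainePstAdicCompletion v ℓ hv).IsDeRhamFramed
                  (ρ.toLocal v)) ∧
            ∀ᶠ v : HeightOneSpectrum (𝓞 K) in cofinite, SatakeFrobCompatibleAt ι π.1 ρ v) :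
    _Goal.stub_weakExistenceOffSector := by
  dsimp only [_Goal.stub_weakExistenceOffSector]
  intro n K _ _ hcpt hn π hL _ ℓ _ ι
  exact hW K n hcpt hn π hL ℓ ι

end Summit.Langlands.Langlands.Cruxes.IrreducibleOffPrimeRankSector.Birth

end
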